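import Mathlib

/-!
# Manin–Gamma cell (pub-manin-gamma0): Lemma 4.3 in group form — powers of `1 + N/t` exhaust `{d ≡ 1 (mod N/t)}` (seat p1, gen 2)

`proofs/T1_lead.md` Lemma 4.3: with `t² ∣ N` and `M := N/t`, the parabolic element `γ_t ∈ Γ₀(N)` has lower-right entry `1 + M`,
and `(1 + M)^k ≡ 1 + kM (mod N)` because `M² = N·(N/t²) ≡ 0 (mod N)`; as `k` varies these are ALL residues `d ≡ 1 (mod M)`.
Hence `H′ ⊇ {d ≡ 1 (mod N/t)}` (the load-bearing truncation for Prop. 4.6(ii)). Here: the two arithmetic facts, over `ℤ`.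

* `ManinGamma.ParabolicSubgroup.one_add_pow_modEq` — `N ∣ M² ⟹ (1 + M)^k ≡ 1 + k M (mod N)`.
* `ManinGamma.ParabolicSubgroup.exists_pow_modEq_of_modEq_one` — `N = M t`, `t ∣ M` (i.e. `t² ∣ N`), `d ≡ 1 (mod M)` ⟹ `∃ k, (1+M)^k ≡ d (mod N)`.
* `ManinGamma.ParabolicSubgroup.mem_of_pow_mem` — packaging: a union of residue classes mod `N` containing all powers of `1 + M` contains all `d ≡ 1 (mod M)`.
Only Mathlib is imported; no `sorry`.
-/

namespace ManinGamma.ParabolicSubgroup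

/-- If `N ∣ M²` then `(1 + M)^k ≡ 1 + k·M (mod N)` for every `k`. -/
theorem one_add_pow_modEq {N M : ℤ} (hM : N ∣ M ^ 2) (k : ℕ) :
    (1 + M) ^ k ≡ 1 + (k : ℤ) * M [ZMOD N] := by
  induction k with
  | zero => simp
  | succ k ih =>
    have h1 : (1 + M) ^ (k + 1) = (1 + M) ^ k * (1 + M) := pow_succ _ _
    rw [h1]
    have h2 : (1 + M) ^ k * (1 + M) ≡ (1 + (k : ℤ) * M) * (1 + M) [ZMOD N] := ih.mul_right _
    refine h2.trans ?_
    -- (1 + kM)(1 + M) = 1 + (k+1)M + k M², and N ∣ M²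
    rw [Int.modEq_iff_dvd]
    obtain ⟨c, hc⟩ := hM
    refine ⟨-(k : ℤ) * c, ?_⟩
    push_cast
    linear_combination (-(k : ℤ)) * hc

/-- Lemma 4.3, group form: let `N = M·t` with `t ∣ M` (equivalently `t² ∣ N`, `M = N/t`), `t ≥ 1`. Then every `d ≡ 1 (mod M)` is
congruent mod `N` to a power of `1 + M`. (So the cyclic subgroup generated by `d(γ_t) = 1 + N/t` is all of `{d ≡ 1 mod N/t}`.) -/
theorem exists_pow_modEq_of_modEq_one {M t d : ℤ} (ht : 0 < t) (htM : t ∣ M) (hd : d ≡ 1 [ZMOD M]) :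
    ∃ k : ℕ, (1 + M) ^ k ≡ d [ZMOD M * t] := by
  -- d - 1 = M * j
  obtain ⟨j, hj⟩ := Int.modEq_iff_dvd.mp hd.symm
  -- choose k : ℕ with k ≡ j (mod t)
  obtain ⟨k, hk⟩ : ∃ k : ℕ, (k : ℤ) ≡ j [ZMOD t] := by
    refine ⟨(j % t).toNat, ?_⟩
    have h0 : 0 ≤ j % t := Int.emod_nonneg _ (ne_of_gt ht)
    rw [Int.toNat_of_nonneg h0]
    exact Int.mod_modEq j t
  refine ⟨k, ?_⟩
  have hN : M * t ∣ M ^ 2 := by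
    obtain ⟨s, hs⟩ := htM
    exact ⟨s, by rw [hs]; ring⟩
  have h1 : (1 + M) ^ k ≡ 1 + (k : ℤ) * M [ZMOD M * t] := one_add_pow_modEq hN k
  refine h1.trans ?_
  -- 1 + k M ≡ d = 1 + j M (mod M t) since t ∣ j - k
  rw [Int.modEq_iff_dvd]
  obtain ⟨r, hr⟩ := Int.modEq_iff_dvd.mp hk         -- j - k = t * r
  refine ⟨r, ?_⟩
  linear_combination hj + M * hr

/-- Packaging for T1_lead Lemma 4.3: with `N = M t`, `t ∣ M`, if a set `H ⊆ ℤ` that is a union of residue classes mod `N` (think: the residues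
of `H′`) contains every power of `1 + M`, then it contains every `d ≡ 1 (mod M)`. -/
theorem mem_of_pow_mem {M t : ℤ} (ht : 0 < t) (htM : t ∣ M) (H : Set ℤ)
    (hH : ∀ x y : ℤ, x ≡ y [ZMOD M * t] → x ∈ H → y ∈ H) (hpow : ∀ k : ℕ, (1 + M) ^ k ∈ H)
    {d : ℤ} (hd : d ≡ 1 [ZMOD M]) : d ∈ H := by
  obtain ⟨k, hk⟩ := exists_pow_modEq_of_modEq_one ht htM hd
  exact hH _ _ hk (hpow k)

end ManinGamma.ParabolicSubgroup
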